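import Summits.AtomisticToContinuum.Crystallization.Theorems.PerronTransitivityTransitiveLocalLimitFiniteForm
import Summits.AtomisticToContinuum.Crystallization.Theorems.PerronTransitivityTransitiveLocalLimitEnergeticDoors
import Summits.AtomisticToContinuum.Crystallization.Theorems.PerronTransitivityTransitiveLocalLimitSuperBoundSparseOfKGroundStates
import Summits.AtomisticToContinuum.Crystallization.Theorems.PhononSlackCertificatesPeriodicGivenLayeredWindowBounds

/-!
# Strategy census R1 (second opinion) for crux `PerronTransitivity.TransitiveLocalLimit`
# (stmt-AtomisticToContinuum-15100) — typed and kernel-checked companion of `STRATEGY-CENSUS-R1.md`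

Seat `cstrat-stmt-AtomisticToContinuum-15100-r1` (planner, redirect strategist, generation 1), 2026-08-17.
A different technique inventory from census s1 (`STRATEGY-CENSUS.md` / `StrategistCensus.lean`: one-centre floor,
two-sided concentration, virial split, Barlow/FK negation).  Here:

* §0 THE CONE.  `closes_of_MT` re-certifies the route's deciding theorem WITHOUT its first hypothesis
  (`UniformBindingRigidity → TransitiveLocalLimit → Crystallization`), and `closes_of_KM` records that, the support
  item `FractionalGainGivesTransitivity` (K* ⇒ T) being CLOSED, `NoFractionalGain → UniformBindingRigidity →
  Crystallization` as well: the load-bearing cone is `{M*, T}` and K* is a LINE for T.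
* §1 THE WEAKEST DOOR.  `WeakSuperBoundSparse` (lim inf form: for every θ, ρ > 0 the θ-super-bound sites — sites bound
  BETTER than the crystal level, `𝓔ⁱ ≤ 2E* − θ` — number `< ρN` for infinitely many `N`) already implies T
  (`transitiveLocalLimit_of_weakSuperBoundSparse`, PROVED: pinned mean + a counting lemma + the landed finite form
  `transitiveLocalLimit_of_goodBalls`).  Its negation is the typed NEGATION TARGET
  (`persistentSuperBound_of_not_transitiveLocalLimit`): a counterexample to T is a ground-state sequence carrying,
  for all large `N`, at least `ρ₀ N` sites that are `θ₀`-super-bound.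
* §2 TRANSFER RESTRICTED TO MINIMISERS.  `GroundStateSiteFloor` (no site of a large ground state is θ-super-bound):
  the siblings' one-centre floor (false over all configurations, s1's `Strategist.not_oneCentreFloor_lennardJones`)
  restricted to minimisers; PROVED `GroundStateSiteFloor → SuperBoundSparse → T`.
* §3 PRICED DEFECTS.  `DefectCountingFloorGS` (`N·E* + κ·#{θ-super-bound} ≤ E(x)` on ground states) — the energetic
  twin of `PricedLinkCensus.ChargedEnergyGap` (stmt-14231) and the 3-D shape of Theil's planar bond count
  (`Literature…Theil2006_shortRangeBonds`); PROVED `K*-on-ground-states → DefectCountingFloorGS → SuperBoundSparse`.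
* §4 REGIME.  `superBound_eq_empty_of_large`: beyond the one-centre constant the super-bound set is empty — the crux
  lives entirely at small `θ`.
* §5 LEVEL-FREE REFORMULATION (decomposition attempt).  `HomogeneousLocalLimit` (some local limit has CONSTANT site
  energy, level unspecified) and the two level lemmas `LevelFloor` / `LevelCap` typed; PROVED
  `T → HomogeneousLocalLimit` and `HomogeneousLocalLimit → LevelFloor → LevelCap → T`.
* §6 THE LEVEL IS FREE (PROVED).  For INFINITE local limits both level lemmas hold: `level_eq_of_localLimit` (an
  infinite homogeneous local limit of ground states has level exactly `2E*`; thin windows + the landed general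
  window bounds `LayeredHull.wb_lower` / `wb_upper` + `crysEnergyLimit`), whence
  `HomogeneousInfiniteLocalLimit → T` (`transitiveLocalLimit_of_homogeneousInfiniteLocalLimit`): the crux is pure
  energy-TRANSITIVITY of some infinite local limit; its level clause carries no difficulty.

No `sorry`.  Nothing here is a route item or a registered line (strategist census only; `no_new_routes`).
-/

noncomputable section

namespace Summit.AtomisticToContinuum.Crystallization.Cruxes.TransitiveLocalLimit.StrategistR1

open Filter Topology
open scoped BigOperators
open Literature.MathematicalPhysics.StatisticalMechanics
open Summit.AtomisticToContinuum.Crystallization.Theses.PerronTransitivity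
  (TransitiveLocalLimit NoFractionalGain UniformBindingRigidity)
open Summit.AtomisticToContinuum.Crystallization.Theorems.TransitiveLocalLimitBirth

/-- `E* = ⨅_Q e_LJ(Q)`, the periodic infimum (= `lim E(N)/N`, landed `crysEnergyLimit`); reducible, so that the
statements below unify with the landed doors verbatim. -/
abbrev eStar : ℝ := ⨅ Q : PeriodicConfiguration 3, Q.energyPerParticle lennardJones

local notation "E⋆" => eStar

/-! ## §0 The cone of the route -/

/-- **The deciding theorem does not use K*.**  Verbatim the proof of `PerronTransitivity.closes` with its first
(underscore-bound) hypothesis deleted: `UniformBindingRigidity → TransitiveLocalLimit → Crystallization`. -/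
theorem closes_of_MT (hM : UniformBindingRigidity) (hT : TransitiveLocalLimit) : _root_.Crystallization := by
  have key : ∀ x : (N : ℕ) → (Fin N → EuclideanSpace ℝ (Fin 3)),
      (∀ N, IsGroundState lennardJones (x N)) →
      ∃ (P : PeriodicConfiguration 3) (σ : ℕ → ℕ) (τ : ℕ → EuclideanSpace ℝ (Fin 3)), StrictMono σ ∧
        (∀ R ε : ℝ, 0 < ε → ∀ᶠ j : ℕ in Filter.atTop,
          (∀ p ∈ P.points, ‖p‖ ≤ R → ∃ i : Fin (σ j), dist (x (σ j) i + τ j) p ≤ ε) ∧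
          (∀ i : Fin (σ j), ‖x (σ j) i + τ j‖ ≤ R → ∃ p ∈ P.points, dist (x (σ j) i + τ j) p ≤ ε)) ∧
        IsLeast (Set.range fun Q : PeriodicConfiguration 3 => Q.energyPerParticle lennardJones)
          (P.energyPerParticle lennardJones) := by
    intro x hx
    obtain ⟨X, σ, τ, hne, hsep, hσ, hlim, hU⟩ := hT x hx
    obtain ⟨P, hPX, hleast⟩ := hM X hne hsep (fun p hp => (hU p hp).le)
    subst hPX
    exact ⟨P, σ, τ, hσ, hlim, hleast⟩
  refine ⟨?_, ?_⟩
  · choose x hx using LennardJonesGroundStatesExist_holds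
    obtain ⟨P, σ, τ, -, -, hleast⟩ := key x hx
    have h : (⨅ Q : PeriodicConfiguration 3, Q.energyPerParticle lennardJones) =
        P.energyPerParticle lennardJones := hleast.csInf_eq
    have hlimE := Summit.AtomisticToContinuum.Crystallization.Theorems.ChargedEnergyGapNegative.crysEnergyLimit
    rw [h] at hlimE
    exact ⟨P, hleast, hlimE⟩
  · intro x hx
    obtain ⟨P, σ, τ, hσ, hlim, -⟩ := key x hx
    obtain ⟨δ, hδ, hδsep⟩ := LennardJonesMinimalDistance_holds
    refine ⟨σ, τ, P, fun _ => 1, hσ, fun s _ => le_rfl, fun g _ s => rfl, ?_⟩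
    intro f hfc hf
    have hsep : ∀ (j : ℕ) (i i' : Fin (σ j)), i ≠ i' →
        δ ≤ dist (x (σ j) i + τ j) (x (σ j) i' + τ j) := by
      intro j i i' hii'
      rw [dist_add_right]
      exact hδsep (σ j) (x (σ j)) (hx (σ j)) i i' hii'
    simpa using P.tendsto_sum_of_eventually_near' (fun j i => x (σ j) i + τ j) hδ hsep hlim hfc hf

/-- **K* and M* alone close the route** (the crux T is then a derived waypoint): composition of
`closes_of_MT` with the closed support item `fractionalGainGivesTransitivity_proof : K* → T`. -/
theorem closes_of_KM (hK : NoFractionalGain) (hM : UniformBindingRigidity) : _root_.Crystallization :=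
  closes_of_MT hM (fractionalGainGivesTransitivity_proof hK)

/-! ## §1 The weakest door: lim inf sparseness of super-bound sites -/

/-- The `θ`-super-bound sites of a finite configuration: sites bound better than the crystal level by `θ`,
`𝓔ⁱ(x) ≤ 2E* − θ`. -/
def superBound {N : ℕ} (θ : ℝ) (x : Fin N → EuclideanSpace ℝ (Fin 3)) : Finset (Fin N) :=
  Finset.univ.filter fun i => siteEnergy lennardJones x i ≤ 2 * E⋆ - θ

/-- **SuperBoundSparse** (= registered stub 1 of line `birth`, the hypothesis of the landed composition
`TransitiveLocalLimit_of_parts`): along every ground-state sequence and for every `θ > 0` the density of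
`θ`-super-bound sites tends to `0`. -/
def SuperBoundSparse : Prop :=
  ∀ x : (N : ℕ) → (Fin N → EuclideanSpace ℝ (Fin 3)), (∀ N, IsGroundState lennardJones (x N)) →
    ∀ θ : ℝ, 0 < θ → Tendsto (fun N : ℕ => ((superBound θ (x N)).card : ℝ) / N) atTop (nhds 0)

/-- **WeakSuperBoundSparse** (lim inf form — the weakest energetic door found): along every ground-state sequence,
for every `θ > 0` and `ρ > 0`, for infinitely many `N` fewer than `ρN` sites are `θ`-super-bound. -/
def WeakSuperBoundSparse : Prop :=
  ∀ x : (N : ℕ) → (Fin N → EuclideanSpace ℝ (Fin 3)), (∀ N, IsGroundState lennardJones (x N)) →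
    ∀ θ ρ : ℝ, 0 < θ → 0 < ρ → ∃ᶠ N : ℕ in atTop, ((superBound θ (x N)).card : ℝ) < ρ * N

/-- The finite form of the crux (landed `transitiveLocalLimit_iff_goodBalls`): frequently in `N` some particle has
its whole `R`-ball `θ`-close to the level. -/
def GoodBalls : Prop :=
  ∀ x : (N : ℕ) → (Fin N → EuclideanSpace ℝ (Fin 3)), (∀ N, IsGroundState lennardJones (x N)) →
    ∀ R θ : ℝ, 0 < θ → ∃ᶠ N in atTop, ∃ i : Fin N, ∀ i' : Fin N, dist (x N i) (x N i') ≤ R →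
      |siteEnergy lennardJones (x N) i' - 2 * E⋆| ≤ θ

/-- `SuperBoundSparse → WeakSuperBoundSparse` (a null sequence is frequently small). -/
theorem weakSuperBoundSparse_of_superBoundSparse (h : SuperBoundSparse) : WeakSuperBoundSparse := by
  intro x hx θ ρ hθ hρ
  have hev : ∀ᶠ N : ℕ in atTop, ((superBound θ (x N)).card : ℝ) / N < ρ :=
    (h x hx θ hθ).eventually (gt_mem_nhds hρ)
  refine ((hev.and (eventually_gt_atTop 0)).mono fun N hN => ?_).frequently
  have hNr : (0 : ℝ) < N := by exact_mod_cast hN.2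
  have := hN.1
  rwa [div_lt_iff₀ hNr] at this

/-- Packing count: in an `r`-separated finite configuration of `ℝ³`, at most `250·r⁻⁶·R⁶ + 1` particles lie within
distance `R > 0` of a given particle (shell sum `sum_inv_pow_six_le`: each such particle other than the centre
contributes at least `R⁻⁶` to `Σ_{k≠b} r_bk⁻⁶ ≤ 250 r⁻⁶`). -/
theorem card_ball_le {N : ℕ} (y : Fin N → EuclideanSpace ℝ (Fin 3)) {r : ℝ} (hr : 0 < r)
    (hsep : ∀ k l, k ≠ l → r ≤ dist (y k) (y l)) {R : ℝ} (hR : 0 < R) (b : Fin N) :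
    ((Finset.univ.filter fun i => dist (y b) (y i) ≤ R).card : ℝ) ≤ 250 * r⁻¹ ^ 6 * R ^ 6 + 1 := by
  classical
  set T := (Finset.univ.erase b).filter fun i => dist (y b) (y i) ≤ R with hT
  have hsub : (Finset.univ.filter fun i => dist (y b) (y i) ≤ R) ⊆ insert b T := by
    intro i hi
    rw [Finset.mem_insert]
    by_cases hib : i = b
    · exact Or.inl hib
    · refine Or.inr ?_
      simp only [hT, Finset.mem_filter, Finset.mem_erase, Finset.mem_univ, and_true, true_and] at hi ⊢
      exact ⟨hib, hi⟩
  have hcard1 : ((Finset.univ.filter fun i => dist (y b) (y i) ≤ R).card : ℝ) ≤ T.card + 1 := by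
    have h1 := Finset.card_le_card hsub
    have h2 := Finset.card_insert_le b T
    exact_mod_cast h1.trans h2
  have hS := sum_inv_pow_six_le y hr hsep b
  have hTsum : (T.card : ℝ) * R⁻¹ ^ 6 ≤ 250 * r⁻¹ ^ 6 := by
    calc (T.card : ℝ) * R⁻¹ ^ 6 = ∑ _i ∈ T, R⁻¹ ^ 6 := by simp [Finset.sum_const, nsmul_eq_mul]
      _ ≤ ∑ i ∈ T, (dist (y b) (y i))⁻¹ ^ 6 := by
          refine Finset.sum_le_sum fun i hi => ?_
          have hd : dist (y b) (y i) ≤ R := (Finset.mem_filter.1 hi).2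
          have hne : i ≠ b := (Finset.mem_erase.1 (Finset.mem_filter.1 hi).1).1
          have hpos : 0 < dist (y b) (y i) := hr.trans_le (hsep b i (Ne.symm hne))
          have h6 : dist (y b) (y i) ^ 6 ≤ R ^ 6 := pow_le_pow_left₀ dist_nonneg hd 6
          have : (R ^ 6)⁻¹ ≤ (dist (y b) (y i) ^ 6)⁻¹ := inv_anti₀ (by positivity) h6
          simpa [inv_pow] using this
      _ ≤ ∑ i ∈ Finset.univ.erase b, (dist (y b) (y i))⁻¹ ^ 6 :=
          Finset.sum_le_sum_of_subset_of_nonneg (Finset.filter_subset _ _) fun i _ _ => by positivity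
      _ ≤ 250 * r⁻¹ ^ 6 := hS
  have hRR : R⁻¹ ^ 6 * R ^ 6 = 1 := by
    rw [← mul_pow, inv_mul_cancel₀ hR.ne', one_pow]
  have hTle : (T.card : ℝ) ≤ 250 * r⁻¹ ^ 6 * R ^ 6 := by
    calc (T.card : ℝ) = T.card * R⁻¹ ^ 6 * R ^ 6 := by rw [mul_assoc, hRR, mul_one]
      _ ≤ 250 * r⁻¹ ^ 6 * R ^ 6 := mul_le_mul_of_nonneg_right hTsum (by positivity)
  linarith

/-- Counting: if the bad set `B` of an `r`-separated `N`-configuration satisfies `#B · (250 r⁻⁶ R⁶ + 1) < N`, some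
particle has NO bad particle within distance `R` (double counting of the pairs (particle, bad particle within `R`)). -/
theorem exists_centre_avoiding {N : ℕ} (y : Fin N → EuclideanSpace ℝ (Fin 3)) {r : ℝ} (hr : 0 < r)
    (hsep : ∀ k l, k ≠ l → r ≤ dist (y k) (y l)) {R : ℝ} (hR : 0 < R) (B : Finset (Fin N))
    (hB : (B.card : ℝ) * (250 * r⁻¹ ^ 6 * R ^ 6 + 1) < N) :
    ∃ i : Fin N, ∀ i' : Fin N, dist (y i) (y i') ≤ R → i' ∉ B := by
  classical
  by_contra h
  push Not at h
  choose f hf hfB using h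
  have hcount : (N : ℝ) ≤ ∑ b ∈ B, ((Finset.univ.filter fun i => dist (y b) (y i) ≤ R).card : ℝ) := by
    have h1 : (Finset.univ : Finset (Fin N)).card =
        ∑ b ∈ B, (Finset.univ.filter fun i : Fin N => f i = b).card :=
      Finset.card_eq_sum_card_fiberwise fun i _ => by simpa using hfB i
    have h2 : ∀ b ∈ B, (Finset.univ.filter fun i : Fin N => f i = b).card ≤
        (Finset.univ.filter fun i => dist (y b) (y i) ≤ R).card := fun b _ =>
      Finset.card_le_card fun i hi => by
        simp only [Finset.mem_filter, Finset.mem_univ, true_and] at hi ⊢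
        rw [← hi, dist_comm]
        exact hf i
    calc (N : ℝ) = ((Finset.univ : Finset (Fin N)).card : ℝ) := by simp
      _ = ((∑ b ∈ B, (Finset.univ.filter fun i : Fin N => f i = b).card : ℕ) : ℝ) := by rw [h1]
      _ = ∑ b ∈ B, ((Finset.univ.filter fun i : Fin N => f i = b).card : ℝ) := by push_cast; rfl
      _ ≤ _ := Finset.sum_le_sum fun b hb => by exact_mod_cast h2 b hb
  have hle : (N : ℝ) ≤ B.card * (250 * r⁻¹ ^ 6 * R ^ 6 + 1) := by
    refine hcount.trans ?_
    calc ∑ b ∈ B, ((Finset.univ.filter fun i => dist (y b) (y i) ≤ R).card : ℝ)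
        ≤ ∑ _b ∈ B, (250 * r⁻¹ ^ 6 * R ^ 6 + 1) := Finset.sum_le_sum fun b _ => card_ball_le y hr hsep hR b
      _ = B.card * (250 * r⁻¹ ^ 6 * R ^ 6 + 1) := by rw [Finset.sum_const, nsmul_eq_mul]
  linarith

/-- **WeakSuperBoundSparse → GoodBalls** (PROVED).  Fix `R, θ`; let `n = 250 δ⁻⁶ R⁶ + 1` (packing count at the
ground-state minimal distance `δ`), `−C` the uniform site-energy floor (`exists_neg_le_siteEnergy`),
`A = |C + 2E*| + 1`, `θ' = θ/(16n)`, `ρ' = θ/(16nA)`.  Frequently in `N` fewer than `min(1/(4n), ρ')·N` sites are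
`θ'`-super-bound (hypothesis), and eventually `2E(N) − 2E*N ≤ θ'N` (`crysEnergyLimit`); at such `N` the counting
inequality `mul_card_filter_le` (pinned mean `Σᵢ𝓔ⁱ = 2E(N)`) bounds the `θ`-SUB-bound sites by `3N/(16n)`, so fewer
than `7N/(16n) < N/n` sites are `θ`-off-level, and `exists_centre_avoiding` gives a particle whose `R`-ball is
`θ`-on-level. -/
theorem goodBalls_of_weakSuperBoundSparse (hW : WeakSuperBoundSparse) : GoodBalls := by
  classical
  intro x hx R θ hθ
  obtain ⟨δ, hδ, hδsep⟩ := LennardJonesMinimalDistance_holds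
  obtain ⟨C, hC⟩ := exists_neg_le_siteEnergy
  -- radius `R' = max R 1 > 0`
  set R' : ℝ := max R 1 with hR'
  have hR'0 : 0 < R' := lt_max_of_lt_right one_pos
  have hRR' : R ≤ R' := le_max_left _ _
  -- packing number and auxiliary constants
  obtain ⟨n, hn⟩ : ∃ n : ℝ, n = 250 * δ⁻¹ ^ 6 * R' ^ 6 + 1 := ⟨_, rfl⟩
  have hn1 : 1 ≤ n := by
    have : 0 ≤ 250 * δ⁻¹ ^ 6 * R' ^ 6 := by positivity
    linarith
  have hn0 : 0 < n := by linarith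
  obtain ⟨A, hA⟩ : ∃ A : ℝ, A = |C + 2 * E⋆| + 1 := ⟨_, rfl⟩
  have hA0 : 0 < A := by rw [hA]; positivity
  have hCA : C + 2 * E⋆ ≤ A := by rw [hA]; linarith [le_abs_self (C + 2 * E⋆)]
  obtain ⟨θ', hθ'⟩ : ∃ t : ℝ, t = θ / (16 * n) := ⟨_, rfl⟩
  have hθ'0 : 0 < θ' := by rw [hθ']; positivity
  have hθ'le : θ' ≤ θ := by
    rw [hθ']
    exact div_le_self hθ.le (by linarith)
  obtain ⟨ρ', hρ'⟩ : ∃ t : ℝ, t = θ / (16 * n * A) := ⟨_, rfl⟩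
  have hρ'0 : 0 < ρ' := by rw [hρ']; positivity
  obtain ⟨ρ₀, hρ₀⟩ : ∃ t : ℝ, t = min (1 / (4 * n)) ρ' := ⟨_, rfl⟩
  have hρ₀0 : 0 < ρ₀ := by rw [hρ₀]; exact lt_min (by positivity) hρ'0
  -- eventually: `N ≥ 1` and `2E(N) − 2E*·N ≤ θ'·N`
  have hev : ∀ᶠ N : ℕ in atTop, 0 < N ∧
      2 * groundStateEnergy lennardJones 3 N - N * (2 * E⋆) ≤ θ' * N := by
    have hlim := Summit.AtomisticToContinuum.Crystallization.Theorems.ChargedEnergyGapNegative.crysEnergyLimit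
    have h1 : ∀ᶠ N : ℕ in atTop, groundStateEnergy lennardJones 3 N / N < E⋆ + θ' / 2 :=
      hlim.eventually (gt_mem_nhds (by show E⋆ < E⋆ + θ' / 2; linarith))
    filter_upwards [h1, eventually_gt_atTop 0] with N hN hN0
    refine ⟨hN0, ?_⟩
    have hNr : (0 : ℝ) < N := by exact_mod_cast hN0
    rw [div_lt_iff₀ hNr] at hN
    nlinarith
  have hfr := (hW x hx θ' ρ₀ hθ'0 hρ₀0).and_eventually hev
  refine hfr.mono fun N hN => ?_
  obtain ⟨hS, hN0, hEN⟩ := hN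
  have hNr : (0 : ℝ) < N := by exact_mod_cast hN0
  have hsepN : ∀ k l, k ≠ l → δ ≤ dist (x N k) (x N l) := hδsep N (x N) (hx N)
  -- the three finite sets
  set S' := superBound θ' (x N) with hS'def
  set T := Finset.univ.filter fun i : Fin N => θ < siteEnergy lennardJones (x N) i - 2 * E⋆ with hTdef
  set B := Finset.univ.filter fun i : Fin N => θ < |siteEnergy lennardJones (x N) i - 2 * E⋆| with hBdef
  -- pinned mean + counting inequality
  have key := mul_card_filter_le (siteEnergy lennardJones (x N)) (L := 2 * E⋆) (θ := θ) hθ'0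
    fun i => hC N (x N) (hx N) i
  rw [← two_mul_interactionEnergy, (hx N).2] at key
  -- `key : θ * #T ≤ (2E(N) − N(2E*)) + (C + 2E*) * #S' + θ' * N`
  obtain ⟨M, hM⟩ : ∃ t : ℝ, t = (N : ℝ) / n := ⟨_, rfl⟩
  have hMn : M * n = N := by rw [hM]; exact div_mul_cancel₀ _ hn0.ne'
  have hM0 : 0 < M := by rw [hM]; positivity
  have hS1 : (S'.card : ℝ) < M / 4 := by
    calc (S'.card : ℝ) < ρ₀ * N := hS
      _ ≤ 1 / (4 * n) * N := by gcongr; rw [hρ₀]; exact min_le_left _ _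
      _ = M / 4 := by rw [hM]; ring
  have hS2 : (S'.card : ℝ) < ρ' * N := by
    calc (S'.card : ℝ) < ρ₀ * N := hS
      _ ≤ ρ' * N := by gcongr; rw [hρ₀]; exact min_le_right _ _
  have hCS : (C + 2 * E⋆) * (S'.card : ℝ) ≤ θ' * N := by
    calc (C + 2 * E⋆) * (S'.card : ℝ) ≤ A * S'.card := by gcongr
      _ ≤ A * (ρ' * N) := by gcongr
      _ = θ' * N := by rw [hρ', hθ']; field_simp
  have hT3 : θ * (T.card : ℝ) ≤ θ * (3 * M / 16) := by
    have h1 : θ * (T.card : ℝ) ≤ 3 * (θ' * N) := by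
      have := key
      simp only [hS'def, superBound] at this hCS ⊢
      linarith
    calc θ * (T.card : ℝ) ≤ 3 * (θ' * N) := h1
      _ = θ * (3 * M / 16) := by rw [hθ', ← hMn]; field_simp
  have hTle : (T.card : ℝ) ≤ 3 * M / 16 := le_of_mul_le_mul_left hT3 hθ
  have hBsub : B ⊆ T ∪ S' := by
    intro i hi
    simp only [hBdef, hTdef, hS'def, superBound, Finset.mem_filter, Finset.mem_univ, true_and,
      Finset.mem_union] at hi ⊢
    rcases le_or_gt 0 (siteEnergy lennardJones (x N) i - 2 * E⋆) with h | h
    · left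
      rwa [abs_of_nonneg h] at hi
    · right
      rw [abs_of_neg h] at hi
      linarith
  have hBcard : (B.card : ℝ) ≤ T.card + S'.card := by
    exact_mod_cast (Finset.card_le_card hBsub).trans (Finset.card_union_le _ _)
  have hBlt : (B.card : ℝ) < 7 * M / 16 := by linarith
  have hBn : (B.card : ℝ) * (250 * δ⁻¹ ^ 6 * R' ^ 6 + 1) < N := by
    rw [← hn]
    calc (B.card : ℝ) * n < 7 * M / 16 * n := mul_lt_mul_of_pos_right hBlt hn0
      _ = 7 / 16 * (M * n) := by ring
      _ = 7 / 16 * N := by rw [hMn]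
      _ < N := by linarith
  obtain ⟨i, hi⟩ := exists_centre_avoiding (x N) hδ hsepN hR'0 B hBn
  refine ⟨i, fun i' hi' => ?_⟩
  have hni := hi i' (hi'.trans hRR')
  simp only [hBdef, Finset.mem_filter, Finset.mem_univ, true_and, not_lt] at hni
  exact hni

/-- **The weakest door decides the crux**: `WeakSuperBoundSparse → TransitiveLocalLimit` (PROVED; the second
step is the landed finite form `transitiveLocalLimit_of_goodBalls`, p156324). -/
theorem transitiveLocalLimit_of_weakSuperBoundSparse (hW : WeakSuperBoundSparse) : TransitiveLocalLimit :=
  transitiveLocalLimit_of_goodBalls (goodBalls_of_weakSuperBoundSparse hW)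

/-- `SuperBoundSparse → TransitiveLocalLimit` (the landed composition of line `birth`, restated by name). -/
theorem transitiveLocalLimit_of_superBoundSparse (h : SuperBoundSparse) : TransitiveLocalLimit :=
  transitiveLocalLimit_of_weakSuperBoundSparse (weakSuperBoundSparse_of_superBoundSparse h)

/-- **NEGATION TARGET (typed).**  If the crux fails, some ground-state sequence carries a PERSISTENT POSITIVE
DENSITY of super-bound sites: there are `θ₀ > 0`, `ρ₀ > 0` with at least `ρ₀·N` sites bound better than the
crystal level by `θ₀`, for all large `N`.  (Contrapositive of the weakest door; by the pinned mean these sites are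
compensated by sub-bound sites, and by `goodBalls` failing they are `R₀`-dense — census §Negation.) -/
theorem persistentSuperBound_of_not_transitiveLocalLimit (h : ¬ TransitiveLocalLimit) :
    ∃ x : (N : ℕ) → (Fin N → EuclideanSpace ℝ (Fin 3)), (∀ N, IsGroundState lennardJones (x N)) ∧
      ∃ θ₀ : ℝ, 0 < θ₀ ∧ ∃ ρ₀ : ℝ, 0 < ρ₀ ∧
        ∀ᶠ N : ℕ in atTop, ρ₀ * N ≤ ((superBound θ₀ (x N)).card : ℝ) := by
  have hW : ¬ WeakSuperBoundSparse := fun hW => h (transitiveLocalLimit_of_weakSuperBoundSparse hW)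
  simp only [WeakSuperBoundSparse, not_forall, Filter.not_frequently, not_lt] at hW
  obtain ⟨x, hx, θ₀, ρ₀, hθ₀, hρ₀, hev⟩ := hW
  exact ⟨x, hx, θ₀, hθ₀, ρ₀, hρ₀, hev⟩

/-! ## §2 Transfer restricted to minimisers: a pointwise site floor on ground states -/

/-- **GroundStateSiteFloor** (the siblings' one-centre floor restricted to minimisers): for every `θ > 0`, for all
large `N`, NO site of an `N`-particle Lennard-Jones ground state is bound better than `2E* − θ`.  Not refuted (the
hedgehog of `not_oneCentreFloor_lennardJones` is not a ground state; the c6 census found no super-bound site in any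
relaxed structured cluster); its proof would need a local exchange argument pricing the frustration around a
super-bound site — census §Transfer. -/
def GroundStateSiteFloor : Prop :=
  ∀ θ : ℝ, 0 < θ → ∀ᶠ N : ℕ in atTop, ∀ x : Fin N → EuclideanSpace ℝ (Fin 3),
    IsGroundState lennardJones x → ∀ i, 2 * E⋆ - θ < siteEnergy lennardJones x i

/-- `GroundStateSiteFloor → SuperBoundSparse` (eventually the super-bound set is empty). -/
theorem superBoundSparse_of_groundStateSiteFloor (h : GroundStateSiteFloor) : SuperBoundSparse := by
  intro x hx θ hθ
  refine tendsto_const_nhds.congr' ?_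
  filter_upwards [h θ hθ] with N hN
  have hempty : superBound θ (x N) = ∅ := by
    refine Finset.filter_eq_empty_iff.2 fun i _ => ?_
    exact not_le.2 (hN (x N) (hx N) i)
  simp [hempty]

/-- Hence `GroundStateSiteFloor → TransitiveLocalLimit` (PROVED door). -/
theorem transitiveLocalLimit_of_groundStateSiteFloor (h : GroundStateSiteFloor) : TransitiveLocalLimit :=
  transitiveLocalLimit_of_superBoundSparse (superBoundSparse_of_groundStateSiteFloor h)

/-! ## §3 Priced defects: the energetic twin of `ChargedEnergyGap` -/

/-- **DefectCountingFloorGS** — priced energetic defects on ground states: for every `θ > 0` there is a price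
`κ > 0` with `N·E* + κ·#{θ-super-bound sites} ≤ E(x)` for every ground state `x`.  The shape of Theil's planar
count `#𝒮(y) ≤ 3N − ½#∂X(y)` (`Theil2006_shortRangeBonds`) and of `PricedLinkCensus.ChargedEnergyGap` (stmt-14231,
geometric charge instead of energetic super-binding). -/
def DefectCountingFloorGS : Prop :=
  ∀ θ : ℝ, 0 < θ → ∃ κ : ℝ, 0 < κ ∧ ∀ (N : ℕ) (x : Fin N → EuclideanSpace ℝ (Fin 3)),
    IsGroundState lennardJones x → N * E⋆ + κ * ((superBound θ x).card : ℝ) ≤ interactionEnergy lennardJones x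

/-- `DefectCountingFloorGS → SuperBoundSparse` (PROVED: `#S/N ≤ (E(N)/N − E*)/κ → 0` by `crysEnergyLimit`). -/
theorem superBoundSparse_of_defectCountingFloorGS (h : DefectCountingFloorGS) : SuperBoundSparse := by
  intro x hx θ hθ
  obtain ⟨κ, hκ, hfloor⟩ := h θ hθ
  have hlim : Tendsto (fun N : ℕ => (groundStateEnergy lennardJones 3 N / N - E⋆) / κ) atTop (nhds 0) := by
    have h := (Summit.AtomisticToContinuum.Crystallization.Theorems.ChargedEnergyGapNegative.crysEnergyLimit).sub_const E⋆
    rw [sub_self] at h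
    simpa using h.div_const κ
  refine squeeze_zero' (Eventually.of_forall fun N => by positivity) ?_ hlim
  filter_upwards [eventually_gt_atTop 0] with N hN
  have hNr : (0 : ℝ) < N := by exact_mod_cast hN
  have hN' := hfloor N (x N) (hx N)
  rw [(hx N).2] at hN'
  rw [div_le_iff₀ hNr]
  have h1 : κ * ((superBound θ (x N)).card : ℝ) ≤ groundStateEnergy lennardJones 3 N - N * E⋆ := by linarith
  have h2 : (groundStateEnergy lennardJones 3 N / N - E⋆) / κ * N =
      (groundStateEnergy lennardJones 3 N - N * E⋆) / κ := by
    field_simp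
  rw [h2, le_div_iff₀ hκ]
  linarith

/-- Hence `DefectCountingFloorGS → TransitiveLocalLimit` (PROVED door). -/
theorem transitiveLocalLimit_of_defectCountingFloorGS (h : DefectCountingFloorGS) : TransitiveLocalLimit :=
  transitiveLocalLimit_of_superBoundSparse (superBoundSparse_of_defectCountingFloorGS h)

/-- **K* on ground states prices energetic defects** (PROVED): copositivity of `[V_ij] − 2E*·I` against
non-negative weights on every ground state gives `DefectCountingFloorGS` with `κ = θ²/(2(C_δ + 2|E*|))`
(`card_superBound_le_of_copositive`, test vector `1 + t·1_S`).  So the door lattice reads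
`K* ⇒ K*|GS ⇒ DefectCountingFloorGS ⇒ SuperBoundSparse ⇒ WeakSuperBoundSparse ⇒ T`. -/
theorem defectCountingFloorGS_of_copositive_groundStates
    (hK : ∀ (N : ℕ) (x : Fin N → EuclideanSpace ℝ (Fin 3)), IsGroundState lennardJones x →
      ∀ c : Fin N → ℝ, (∀ i, 0 ≤ c i) → 2 * E⋆ * ∑ i, c i ^ 2 ≤
        ∑ i, ∑ j ∈ Finset.univ.erase i, c i * c j * lennardJones (dist (x i) (x j))) :
    DefectCountingFloorGS := by
  intro θ hθ
  obtain ⟨δ, hδ, hδsep⟩ := LennardJonesMinimalDistance_holds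
  set C : ℝ := (δ⁻¹ ^ 6 / 12 + 1 / 6) * (250 * δ⁻¹ ^ 6) with hC
  have hC0 : 0 < C := by positivity
  set A : ℝ := C + 2 * |E⋆| with hA
  have hA0 : 0 < A := by positivity
  refine ⟨θ ^ 2 / (2 * A), by positivity, fun N x hxg => ?_⟩
  have hcard : ((superBound θ x).card : ℝ) ≤ 2 * A / θ ^ 2 * (interactionEnergy lennardJones x - N * E⋆) := by
    refine card_superBound_le_of_copositive x hC0 (fun i => ?_) hθ fun c hc => hK N x hxg c hc
    exact sum_abs_lennardJones_erase_le x hδ (fun k l hkl => hδsep N x hxg k l hkl) i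
  have h2 : θ ^ 2 / (2 * A) * ((superBound θ x).card : ℝ) ≤ interactionEnergy lennardJones x - N * E⋆ := by
    calc θ ^ 2 / (2 * A) * ((superBound θ x).card : ℝ)
        ≤ θ ^ 2 / (2 * A) * (2 * A / θ ^ 2 * (interactionEnergy lennardJones x - N * E⋆)) := by gcongr
      _ = interactionEnergy lennardJones x - N * E⋆ := by field_simp
  linarith

/-- `NoFractionalGain` (K*, all injective configurations) restricts to ground states. -/
theorem defectCountingFloorGS_of_noFractionalGain (hK : NoFractionalGain) : DefectCountingFloorGS :=
  defectCountingFloorGS_of_copositive_groundStates fun N x hx c hc => hK N x hx.1 c hc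

/-! ## §4 Regime: the crux lives at small `θ` -/

/-- Beyond the one-centre constant nothing is asked: with `−C` the uniform site-energy floor of
`exists_neg_le_siteEnergy`, for `θ > C + 2E*` NO site of ANY ground state is `θ`-super-bound.  (So
`WeakSuperBoundSparse` is free for large `θ`; the sharp one-centre constant — the hedgehog optimum — is strictly
below `2E*`, `not_oneCentreFloor_lennardJones`, and the whole crux is the window `0 < θ ≤ 2E* − inf 𝓔`.) -/
theorem superBound_eq_empty_of_large :
    ∃ C : ℝ, ∀ θ : ℝ, C + 2 * E⋆ < θ → ∀ (N : ℕ) (x : Fin N → EuclideanSpace ℝ (Fin 3)),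
      IsGroundState lennardJones x → superBound θ x = ∅ := by
  obtain ⟨C, hC⟩ := exists_neg_le_siteEnergy
  refine ⟨C, fun θ hθ N x hx => Finset.filter_eq_empty_iff.2 fun i _ => ?_⟩
  have := hC N x hx i
  exact not_le.2 (by linarith)

/-! ## §5 Level-free reformulation: the crux is pure energy-transitivity -/

/-- **HomogeneousLocalLimit** — the crux with the level clause deleted: every ground-state sequence has a local
limit (same matching clause as the crux) whose site energies are all EQUAL (to an unspecified level `L`). -/
def HomogeneousLocalLimit : Prop :=
  ∀ x : (N : ℕ) → (Fin N → EuclideanSpace ℝ (Fin 3)), (∀ N, IsGroundState lennardJones (x N)) →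
    ∃ (X : Set (EuclideanSpace ℝ (Fin 3))) (σ : ℕ → ℕ) (τ : ℕ → EuclideanSpace ℝ (Fin 3)) (L : ℝ),
      X.Nonempty ∧ (∃ δ : ℝ, 0 < δ ∧ ∀ p ∈ X, ∀ q ∈ X, p ≠ q → δ ≤ dist p q) ∧ StrictMono σ ∧
      (∀ R ε : ℝ, 0 < ε → ∀ᶠ j : ℕ in atTop,
        (∀ p ∈ X, ‖p‖ ≤ R → ∃ i : Fin (σ j), dist (x (σ j) i + τ j) p ≤ ε) ∧
        (∀ i : Fin (σ j), ‖x (σ j) i + τ j‖ ≤ R → ∃ p ∈ X, dist (x (σ j) i + τ j) p ≤ ε)) ∧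
      ∀ p ∈ X, ∑' q : {q : EuclideanSpace ℝ (Fin 3) // q ∈ X ∧ q ≠ p}, lennardJones (dist p q.1) = L

/-- **LevelFloor** (support-sized, provable now — not proved here): a non-empty uniformly discrete `X ⊆ ℝ³` all of
whose Lennard-Jones site sums equal `L` has `2E* ≤ L`.  Sketch: the `n(R)` points of `X` in a ball form a finite
configuration of energy `≥ n(R)·E*` (`card_mul_eStar_le`, periodisation) and of energy
`½ n(R) L − ½·(cross terms) = ½ n(R) L + o(n(R))` along a sequence of radii (r⁻⁶ tails on δ-separated sets and a
thin-annulus subsequence); for finite `X` take `R` beyond all points. -/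
def LevelFloor : Prop :=
  ∀ (X : Set (EuclideanSpace ℝ (Fin 3))) (L : ℝ), X.Nonempty →
    (∃ δ : ℝ, 0 < δ ∧ ∀ p ∈ X, ∀ q ∈ X, p ≠ q → δ ≤ dist p q) →
    (∀ p ∈ X, ∑' q : {q : EuclideanSpace ℝ (Fin 3) // q ∈ X ∧ q ≠ p}, lennardJones (dist p q.1) = L) →
    2 * E⋆ ≤ L

/-- **LevelCap** (support-sized, provable now — not proved here; the half that USES minimality): a homogeneous
local limit of Lennard-Jones ground states has level `L ≤ 2E*`.  Sketch (cluster relocation): if `L > 2E* + 2γ`,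
eventually the `m ≍ R³` particles matched inside `‖·‖ ≤ R − R₀` all have `𝓔ⁱ ≥ L − γ` (landed site-energy
continuity `stub_siteEnergyContinuity`); deleting them and adding a far-away translate of an `m`-particle
near-minimiser changes the energy by `≤ m(E* + o(1)) − ½Σ_W 𝓔ⁱ + ½|E(W, Wᶜ)| ≤ m(E* − L/2 + γ/2 + o(1)) < 0`,
contradicting minimality. -/
def LevelCap : Prop :=
  ∀ x : (N : ℕ) → (Fin N → EuclideanSpace ℝ (Fin 3)), (∀ N, IsGroundState lennardJones (x N)) →
    ∀ (X : Set (EuclideanSpace ℝ (Fin 3))) (σ : ℕ → ℕ) (τ : ℕ → EuclideanSpace ℝ (Fin 3)) (L : ℝ),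
      X.Nonempty → (∃ δ : ℝ, 0 < δ ∧ ∀ p ∈ X, ∀ q ∈ X, p ≠ q → δ ≤ dist p q) → StrictMono σ →
      (∀ R ε : ℝ, 0 < ε → ∀ᶠ j : ℕ in atTop,
        (∀ p ∈ X, ‖p‖ ≤ R → ∃ i : Fin (σ j), dist (x (σ j) i + τ j) p ≤ ε) ∧
        (∀ i : Fin (σ j), ‖x (σ j) i + τ j‖ ≤ R → ∃ p ∈ X, dist (x (σ j) i + τ j) p ≤ ε)) →
      (∀ p ∈ X, ∑' q : {q : EuclideanSpace ℝ (Fin 3) // q ∈ X ∧ q ≠ p}, lennardJones (dist p q.1) = L) →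
      L ≤ 2 * E⋆

/-- The crux trivially gives a homogeneous local limit (level `2E*`). -/
theorem homogeneousLocalLimit_of_transitiveLocalLimit (h : TransitiveLocalLimit) : HomogeneousLocalLimit := by
  intro x hx
  obtain ⟨X, σ, τ, hne, hsep, hσ, hlim, hU⟩ := h x hx
  exact ⟨X, σ, τ, 2 * E⋆, hne, hsep, hσ, hlim, hU⟩

/-- **Assembly of the level-free split** (PROVED): a homogeneous local limit plus the two level lemmas IS the crux.
Modulo `LevelFloor`/`LevelCap` (support-sized), `TransitiveLocalLimit ⟺ HomogeneousLocalLimit`: the level clause of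
the crux carries no difficulty; all of it is energy-TRANSITIVITY of some local limit. -/
theorem transitiveLocalLimit_of_homogeneous (hA : HomogeneousLocalLimit) (hF : LevelFloor) (hC : LevelCap) :
    TransitiveLocalLimit := by
  intro x hx
  obtain ⟨X, σ, τ, L, hne, hsep, hσ, hlim, hU⟩ := hA x hx
  have h1 : 2 * E⋆ ≤ L := hF X L hne hsep hU
  have h2 : L ≤ 2 * E⋆ := hC x hx X σ τ L hne hsep hσ hlim hU
  have hL : L = 2 * E⋆ := le_antisymm h2 h1
  exact ⟨X, σ, τ, hne, hsep, hσ, hlim, fun p hp => (hU p hp).trans hL⟩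

/-! ## §6 The level is free: `LevelFloor` / `LevelCap` PROVED for infinite local limits

The two level lemmas of §5 HOLD for infinite local limits, by the landed GENERAL window bounds of the 11779 line —
`LayeredHull.wb_lower` (periodisation; needs only separation) and `LayeredHull.wb_upper` (cut-and-paste in the
finite ground states; needs the hull) — evaluated on THIN WINDOWS `X ∩ B̄(0, R)` (boundary weight `≤ η·#window`
along suitable radii, `exists_thin_window`: otherwise the counts `#(X ∩ B̄(0, R₀ + kℓ))` would grow geometrically,
against the packing bound `(2R/δ + 1)³`), together with `E(n)/n → E*` (`crysEnergyLimit`) and `n·E* ≤ E(n)`.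
This is `TransitiveLocalLimitMotifTwo.stub_level` with balls in place of prisms and an ARBITRARY homogeneous hull
set in place of a layered one.  Consequently (`transitiveLocalLimit_of_homogeneousInfiniteLocalLimit`) the crux is
implied by — and, up to the exclusion of finite local limits (isolated clusters, which minimality forbids; not
formalised, not needed in this direction), equivalent to — "every ground-state sequence has an INFINITE local
limit whose site energies are all equal": the level `2E*` of the crux costs nothing; all of it is TRANSITIVITY.
-/

/-- The matching clause of the crux (a subsequence `σ` and translations `τ`, EVENTUALLY in `j`) gives the HULL
form consumed by the landed window bounds: two-way matched by translates of `x N`, FREQUENTLY in `N`. -/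
theorem hull_of_localLimit {x : (N : ℕ) → (Fin N → EuclideanSpace ℝ (Fin 3))}
    {X : Set (EuclideanSpace ℝ (Fin 3))} {σ : ℕ → ℕ} {τ : ℕ → EuclideanSpace ℝ (Fin 3)} (hσ : StrictMono σ)
    (hlim : ∀ R ε : ℝ, 0 < ε → ∀ᶠ j : ℕ in atTop,
        (∀ p ∈ X, ‖p‖ ≤ R → ∃ i : Fin (σ j), dist (x (σ j) i + τ j) p ≤ ε) ∧
        (∀ i : Fin (σ j), ‖x (σ j) i + τ j‖ ≤ R → ∃ p ∈ X, dist (x (σ j) i + τ j) p ≤ ε)) :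
    ∀ R ε : ℝ, 0 < ε → ∃ᶠ N in atTop, ∃ t : EuclideanSpace ℝ (Fin 3),
        (∀ p ∈ X, ‖p‖ ≤ R → ∃ i : Fin N, dist (x N i + t) p ≤ ε) ∧
        (∀ i : Fin N, ‖x N i + t‖ ≤ R → ∃ p ∈ X, dist (x N i + t) p ≤ ε) := by
  intro R ε hε
  have h1 : ∃ᶠ j : ℕ in atTop, ∃ t : EuclideanSpace ℝ (Fin 3),
      (∀ p ∈ X, ‖p‖ ≤ R → ∃ i : Fin (σ j), dist (x (σ j) i + t) p ≤ ε) ∧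
        (∀ i : Fin (σ j), ‖x (σ j) i + t‖ ≤ R → ∃ p ∈ X, dist (x (σ j) i + t) p ≤ ε) :=
    ((hlim R ε hε).mono fun j hj => ⟨τ j, hj⟩).frequently
  exact hσ.tendsto_atTop.frequently h1

/-- **Thin windows.** An infinite `δ`-separated `S ⊆ ℝ³` has, for every `η > 0` and every `n₀`, a finite window
`W ⊆ S` with more than `n₀` points and boundary weight `Σ_{p ∈ W} (1 + dist(p, S ∖ W))⁻³ ≤ η·#W`.  Windows
`W_k = S ∩ B̄(0, R₀ + kℓ)` with `ℓ = 2/η`: a point of `W_k` is `ℓ`-deep in `W_{k+1}` (weight `≤ η/2`), so if NO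
`W_{k+1}` were thin then `#W_k < (1 − η/2)·#W_{k+1}` for all `k` — geometric growth, against the packing bound
`#W_k ≤ (2(R₀ + kℓ)/δ + 1)³` (`card_le_of_separated_of_dist_le`). [folklore] -/
theorem exists_thin_window {S : Set (EuclideanSpace ℝ (Fin 3))} {δ : ℝ} (hδ : 0 < δ)
    (hsep : ∀ p ∈ S, ∀ q ∈ S, p ≠ q → δ ≤ dist p q) (hinf : S.Infinite) {η : ℝ} (hη : 0 < η) (n₀ : ℕ) :
    ∃ W : Finset (EuclideanSpace ℝ (Fin 3)), (↑W : Set (EuclideanSpace ℝ (Fin 3))) ⊆ S ∧ n₀ + 1 ≤ W.card ∧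
      ∑ p ∈ W, (1 + Metric.infDist p (S \ ↑W))⁻¹ ^ 3 ≤ η * W.card := by
  classical
  -- each boundary weight lies in `[0, 1]`
  have hw1 : ∀ (p : EuclideanSpace ℝ (Fin 3)) (T : Set (EuclideanSpace ℝ (Fin 3))),
      (1 + Metric.infDist p T)⁻¹ ^ 3 ≤ 1 := fun p T => by
    have h0 : 0 ≤ Metric.infDist p T := Metric.infDist_nonneg
    exact pow_le_one₀ (inv_nonneg.2 (by linarith)) (inv_le_one_of_one_le₀ (by linarith))
  -- the case `1 ≤ η` is trivial; reduce to `η ≤ 1`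
  wlog hη1 : η ≤ 1 generalizing η with H
  · obtain ⟨W, hWS, hcard, hB⟩ := H one_pos le_rfl
    refine ⟨W, hWS, hcard, hB.trans ?_⟩
    have h0 : (0 : ℝ) ≤ W.card := Nat.cast_nonneg _
    nlinarith [le_of_not_ge hη1]
  -- a seed `t₀ ⊆ S` of `n₀ + 1` points inside `B̄(0, R₀)`
  obtain ⟨t₀, ht₀S, ht₀card⟩ := hinf.exists_subset_card_eq (n₀ + 1)
  set R₀ : ℝ := ∑ p ∈ t₀, ‖p‖ with hR₀
  have hR₀0 : 0 ≤ R₀ := Finset.sum_nonneg fun p _ => norm_nonneg p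
  have ht₀R : ∀ p ∈ t₀, ‖p‖ ≤ R₀ := fun p hp =>
    Finset.single_le_sum (f := fun q => ‖q‖) (fun q _ => norm_nonneg q) hp
  -- step `ℓ = 2/η`, radii `R k = R₀ + kℓ`, windows `W k = S ∩ B̄(0, R k)`
  set ℓ : ℝ := 2 / η with hℓ
  have hℓ0 : 0 < ℓ := by positivity
  have hℓw : (1 + ℓ)⁻¹ ^ 3 ≤ η / 2 := by
    have h1 : (1 + ℓ)⁻¹ ≤ ℓ⁻¹ := inv_anti₀ hℓ0 (by linarith)
    have h2 : ℓ⁻¹ = η / 2 := by rw [hℓ, inv_div]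
    have h3 : 0 ≤ (1 + ℓ)⁻¹ := inv_nonneg.2 (by linarith)
    have h4 : (1 + ℓ)⁻¹ ≤ 1 := inv_le_one_of_one_le₀ (by linarith)
    calc (1 + ℓ)⁻¹ ^ 3 ≤ (1 + ℓ)⁻¹ := pow_le_of_le_one h3 h4 (by norm_num)
      _ ≤ η / 2 := h1.trans_eq h2
  set R : ℕ → ℝ := fun k => R₀ + k * ℓ with hRdef
  have hR0 : ∀ k, 0 ≤ R k := fun k => by positivity
  have hRsucc : ∀ k, R (k + 1) = R k + ℓ := fun k => by simp only [hRdef]; push_cast; ring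
  have hfin : ∀ k, ({p | p ∈ S ∧ ‖p‖ ≤ R k} : Set (EuclideanSpace ℝ (Fin 3))).Finite := fun k =>
    finite_of_forall_le_dist_of_subset_closedBall hδ (fun p hp q hq hpq => hsep p hp.1 q hq.1 hpq)
      (c := 0) (R := R k) fun p hp => mem_closedBall_zero_iff.2 hp.2
  set W : ℕ → Finset (EuclideanSpace ℝ (Fin 3)) := fun k => (hfin k).toFinset with hWdef
  have hmemW : ∀ k p, p ∈ W k ↔ p ∈ S ∧ ‖p‖ ≤ R k := fun k p => by
    simp only [hWdef, Set.Finite.mem_toFinset, Set.mem_setOf_eq]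
  have hWS : ∀ k, (↑(W k) : Set (EuclideanSpace ℝ (Fin 3))) ⊆ S := fun k p hp =>
    ((hmemW k p).1 (Finset.mem_coe.1 hp)).1
  have hWmono : ∀ k, W k ⊆ W (k + 1) := fun k p hp => by
    rw [hmemW] at hp ⊢
    exact ⟨hp.1, hp.2.trans (by linarith [hRsucc k, hℓ0.le])⟩
  have ht₀W : ∀ k, t₀ ⊆ W k := fun k p hp => by
    rw [hmemW]
    refine ⟨ht₀S (Finset.mem_coe.2 hp), (ht₀R p hp).trans ?_⟩
    have : (0 : ℝ) ≤ k * ℓ := by positivity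
    show R₀ ≤ R₀ + k * ℓ
    linarith
  have hcard₀ : ∀ k, n₀ + 1 ≤ (W k).card := fun k => ht₀card ▸ Finset.card_le_card (ht₀W k)
  -- packing: `#W k ≤ (2 R k / δ + 1)³`
  have hpack : ∀ k, ((W k).card : ℝ) ≤ (2 * R k / δ + 1) ^ 3 := fun k => by
    have h := card_le_of_separated_of_dist_le (W k) 0 hδ (hR0 k)
      (fun c hc => by rw [dist_zero_right]; exact ((hmemW k c).1 hc).2)
      (fun c hc d hd hcd => hsep c ((hmemW k c).1 hc).1 d ((hmemW k d).1 hd).1 hcd)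
    rwa [finrank_euclideanSpace_fin] at h
  -- boundary weight of `W (k+1)`: the points of `W k` are `ℓ`-deep
  have hB : ∀ k, ∑ p ∈ W (k + 1), (1 + Metric.infDist p (S \ ↑(W (k + 1))))⁻¹ ^ 3 ≤
      (((W (k + 1)).card : ℝ) - (W k).card) + η / 2 * (W k).card := fun k => by
    have hne : (S \ ↑(W (k + 1))).Nonempty := (hinf.sdiff (W (k + 1)).finite_toSet).nonempty
    rw [← Finset.sum_sdiff (hWmono k)]
    have hout : ∑ p ∈ W (k + 1) \ W k, (1 + Metric.infDist p (S \ ↑(W (k + 1))))⁻¹ ^ 3 ≤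
        ((W (k + 1)).card : ℝ) - (W k).card := by
      have h1 : ∑ p ∈ W (k + 1) \ W k, (1 + Metric.infDist p (S \ ↑(W (k + 1))))⁻¹ ^ 3 ≤
          ∑ p ∈ W (k + 1) \ W k, (1 : ℝ) := Finset.sum_le_sum fun p _ => hw1 p _
      have h2 : ∑ p ∈ W (k + 1) \ W k, (1 : ℝ) = ((W (k + 1) \ W k).card : ℝ) := by simp
      have h3 : (((W (k + 1) \ W k).card : ℕ) : ℝ) + (W k).card = (W (k + 1)).card := by
        exact_mod_cast Finset.card_sdiff_add_card_eq_card (hWmono k)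
      linarith
    have hin : ∑ p ∈ W k, (1 + Metric.infDist p (S \ ↑(W (k + 1))))⁻¹ ^ 3 ≤ η / 2 * (W k).card := by
      have h1 : ∀ p ∈ W k, (1 + Metric.infDist p (S \ ↑(W (k + 1))))⁻¹ ^ 3 ≤ η / 2 := by
        intro p hp
        have hpR : ‖p‖ ≤ R k := ((hmemW k p).1 hp).2
        have hdeep : ℓ ≤ Metric.infDist p (S \ ↑(W (k + 1))) := by
          refine (Metric.le_infDist hne).2 fun q hq => ?_
          have hqW : q ∉ W (k + 1) := fun h => hq.2 (Finset.mem_coe.2 h)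
          have hqR : R (k + 1) < ‖q‖ := by
            by_contra hle
            exact hqW ((hmemW (k + 1) q).2 ⟨hq.1, not_lt.1 hle⟩)
          have h1 : ‖q‖ - ‖p‖ ≤ dist p q := by
            rw [dist_comm, dist_eq_norm]
            exact norm_sub_norm_le q p
          linarith [hRsucc k]
        have h0 : 0 ≤ Metric.infDist p (S \ ↑(W (k + 1))) := Metric.infDist_nonneg
        have h3 : 0 ≤ (1 + Metric.infDist p (S \ ↑(W (k + 1))))⁻¹ := inv_nonneg.2 (by linarith)
        have h4 : (1 + Metric.infDist p (S \ ↑(W (k + 1))))⁻¹ ≤ (1 + ℓ)⁻¹ :=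
          inv_anti₀ (by linarith) (by linarith)
        calc (1 + Metric.infDist p (S \ ↑(W (k + 1))))⁻¹ ^ 3 ≤ (1 + ℓ)⁻¹ ^ 3 :=
              pow_le_pow_left₀ h3 h4 3
          _ ≤ η / 2 := hℓw
      calc ∑ p ∈ W k, (1 + Metric.infDist p (S \ ↑(W (k + 1))))⁻¹ ^ 3 ≤ ∑ _p ∈ W k, η / 2 :=
            Finset.sum_le_sum h1
        _ = η / 2 * (W k).card := by rw [Finset.sum_const, nsmul_eq_mul, mul_comm]
    linarith
  -- if NO `W (k+1)` were thin, the counts would grow geometrically …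
  by_contra hcon
  push Not at hcon
  have hgrow : ∀ k, ((W k).card : ℝ) < (1 - η / 2) * (W (k + 1)).card := fun k => by
    have h := hcon (W (k + 1)) (hWS (k + 1)) (hcard₀ (k + 1))
    have h' := hB k
    have hmono : ((W k).card : ℝ) ≤ (W (k + 1)).card := by exact_mod_cast Finset.card_le_card (hWmono k)
    have hmono' : η / 2 * (W k).card ≤ η / 2 * (W (k + 1)).card := by gcongr
    linarith
  have hη2 : 0 < 1 - η / 2 := by linarith
  set q : ℝ := (1 - η / 2)⁻¹ with hq
  have hq1 : 1 < q := (one_lt_inv₀ hη2).2 (by linarith)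
  have hq0 : 0 ≤ q := by linarith
  have hgeo : ∀ k, q ^ k ≤ (W k).card := by
    intro k
    induction k with
    | zero =>
      have h : 1 ≤ (W 0).card := (Nat.le_add_left 1 n₀).trans (hcard₀ 0)
      rw [pow_zero]
      exact_mod_cast h
    | succ k ih =>
      have h2 : ((W k).card : ℝ) * q ≤ (W (k + 1)).card := by
        rw [hq, ← div_eq_mul_inv, div_le_iff₀ hη2]
        linarith [hgrow k]
      calc q ^ (k + 1) = q ^ k * q := pow_succ q k
        _ ≤ (W k).card * q := by gcongr
        _ ≤ (W (k + 1)).card := h2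
  -- … against the cubic packing bound
  set M : ℝ := (2 * (R₀ + ℓ) / δ + 1) ^ 3 with hMdef
  have hM0 : 0 < M := by positivity
  have hM : ∀ k, ((W k).card : ℝ) ≤ M * ((k : ℝ) + 1) ^ 3 := fun k => by
    have hk0 : (0 : ℝ) ≤ k := Nat.cast_nonneg k
    have h2 : 2 * R k / δ + 1 ≤ (2 * (R₀ + ℓ) / δ + 1) * ((k : ℝ) + 1) := by
      have ha : 2 * R k / δ ≤ 2 * (R₀ + ℓ) / δ * ((k : ℝ) + 1) := by
        rw [div_mul_eq_mul_div, div_le_div_iff_of_pos_right hδ]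
        have hRk : R k = R₀ + k * ℓ := rfl
        rw [hRk]
        linarith [mul_nonneg hR₀0 hk0, mul_nonneg hℓ0.le hk0]
      linarith [ha, hk0]
    have h0 : 0 ≤ 2 * R k / δ + 1 := by have := hR0 k; positivity
    calc ((W k).card : ℝ) ≤ (2 * R k / δ + 1) ^ 3 := hpack k
      _ ≤ ((2 * (R₀ + ℓ) / δ + 1) * ((k : ℝ) + 1)) ^ 3 := pow_le_pow_left₀ h0 h2 3
      _ = M * ((k : ℝ) + 1) ^ 3 := by rw [hMdef]; ring
  have hlim : Tendsto (fun k : ℕ => ((k : ℝ) + 1) ^ 3 / q ^ (k + 1)) atTop (nhds 0) := by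
    have h := (tendsto_pow_const_div_const_pow_of_one_lt 3 hq1).comp (tendsto_add_atTop_nat 1)
    refine h.congr' (Filter.Eventually.of_forall fun k => ?_)
    simp only [Function.comp_apply, Nat.cast_add, Nat.cast_one]
  have hev : ∀ᶠ k : ℕ in atTop, ((k : ℝ) + 1) ^ 3 / q ^ (k + 1) < (M * q)⁻¹ :=
    hlim.eventually (gt_mem_nhds (by positivity))
  obtain ⟨k, hk⟩ := hev.exists
  have hqk : 0 < q ^ (k + 1) := pow_pos (by linarith) _
  rw [div_lt_iff₀ hqk] at hk
  have h3 : q ^ k ≤ M * ((k : ℝ) + 1) ^ 3 := (hgeo k).trans (hM k)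
  have h5 : (M * q)⁻¹ * q ^ (k + 1) = M⁻¹ * q ^ k := by
    rw [mul_inv, pow_succ]
    field_simp
  have h6 : M⁻¹ * q ^ k ≤ ((k : ℝ) + 1) ^ 3 := by
    rw [inv_mul_le_iff₀ hM0]
    exact h3
  linarith

/-- **The level of an infinite homogeneous hull set is `2E*`.**  If `S ⊆ ℝ³` is infinite, lies in the hull of a
sequence of Lennard-Jones ground states (two-way matched on every ball by translates of `x N`, frequently in `N`)
and all its site sums `Σ'_{q ∈ S, q ≠ p} V_LJ(|p − q|)` equal `L`, then `L = 2E*`.  On a thin window `W`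
(`exists_thin_window`) the site sums add up to `#W·L`, squeezed between `2E(#W) ∓ C·η·#W` by the landed window
bounds `LayeredHull.wb_lower` / `LayeredHull.wb_upper`; and `#W·E* ≤ E(#W) ≤ #W·(E* + o(1))`
(`eStar_le_groundStateEnergy_div`, `crysEnergyLimit`). [folklore] -/
theorem level_eq_of_hull_homogeneous {x : (N : ℕ) → (Fin N → EuclideanSpace ℝ (Fin 3))}
    (hx : ∀ N, IsGroundState lennardJones (x N)) {S : Set (EuclideanSpace ℝ (Fin 3))} (hinf : S.Infinite)
    (hhull : ∀ R ε : ℝ, 0 < ε → ∃ᶠ N in atTop, ∃ t : EuclideanSpace ℝ (Fin 3),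
        (∀ p ∈ S, ‖p‖ ≤ R → ∃ i : Fin N, dist (x N i + t) p ≤ ε) ∧
        (∀ i : Fin N, ‖x N i + t‖ ≤ R → ∃ p ∈ S, dist (x N i + t) p ≤ ε))
    {L : ℝ} (hL : ∀ p ∈ S, ∑' q : {q : EuclideanSpace ℝ (Fin 3) // q ∈ S ∧ q ≠ p},
      lennardJones (dist p q.1) = L) :
    L = 2 * E⋆ := by
  classical
  obtain ⟨δ, hδ, hsepx⟩ := LennardJonesMinimalDistance_holds
  have hS : ∀ p ∈ S, ∀ q ∈ S, p ≠ q → δ ≤ dist p q :=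
    Summit.AtomisticToContinuum.Crystallization.Theorems.LayeredHull.wb_sep_of_hull δ x hx hsepx S hhull
  obtain ⟨CU, hCU⟩ := Summit.AtomisticToContinuum.Crystallization.Theorems.LayeredHull.wb_upper
  obtain ⟨CL, hCL⟩ := Summit.AtomisticToContinuum.Crystallization.Theorems.LayeredHull.wb_lower δ hδ
  -- window sums of a homogeneous set, and the sign of the boundary weight
  have hsumL : ∀ W : Finset (EuclideanSpace ℝ (Fin 3)), (↑W : Set (EuclideanSpace ℝ (Fin 3))) ⊆ S →
      ∑ p ∈ W, (∑' q : {q : EuclideanSpace ℝ (Fin 3) // q ∈ S ∧ q ≠ p}, lennardJones (dist p q.1)) =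
        W.card * L := fun W hW => by
    rw [Finset.sum_congr rfl fun p hp => hL p (hW (Finset.mem_coe.2 hp)), Finset.sum_const, nsmul_eq_mul]
  have hB0 : ∀ W : Finset (EuclideanSpace ℝ (Fin 3)),
      0 ≤ ∑ p ∈ W, (1 + Metric.infDist p (S \ ↑W))⁻¹ ^ 3 := fun W =>
    Finset.sum_nonneg fun p _ => pow_nonneg (inv_nonneg.2 (by
      linarith [(Metric.infDist_nonneg : 0 ≤ Metric.infDist p (S \ ↑W))])) 3
  have hCη : ∀ (C γ : ℝ), 0 < γ → ∀ (B n : ℝ), 0 ≤ B → 0 ≤ n → B ≤ γ / (2 * (|C| + 1)) * n →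
      |C * B| ≤ γ / 2 * n := by
    intro C γ hγ B n hB hn hle
    rw [abs_mul, abs_of_nonneg hB]
    have h1 : |C| * B ≤ |C| * (γ / (2 * (|C| + 1)) * n) := mul_le_mul_of_nonneg_left hle (abs_nonneg C)
    have h2 : |C| * (γ / (2 * (|C| + 1))) ≤ γ / 2 := by
      rw [mul_div_assoc', div_le_iff₀ (by positivity)]
      nlinarith [abs_nonneg C]
    nlinarith
  have hElim := Summit.AtomisticToContinuum.Crystallization.Theorems.ChargedEnergyGapNegative.crysEnergyLimit
  refine le_antisymm (le_of_forall_pos_lt_add fun γ hγ => ?_) (le_of_forall_pos_lt_add fun γ hγ => ?_)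
  · -- `L < 2E* + γ`: a LARGE thin window, (U) and `E(n)/n → E*`
    have hev : ∀ᶠ n : ℕ in atTop, groundStateEnergy lennardJones 3 n / n < E⋆ + γ / 4 :=
      hElim.eventually (gt_mem_nhds (by show E⋆ < E⋆ + γ / 4; linarith))
    obtain ⟨n₀, hn₀⟩ := Filter.eventually_atTop.1 hev
    have hη0 : 0 < γ / (2 * (|CU| + 1)) := by positivity
    obtain ⟨W, hWS, hcard, hB⟩ := exists_thin_window hδ hS hinf hη0 n₀
    have hposN : 0 < W.card := lt_of_lt_of_le (Nat.succ_pos n₀) hcard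
    have hn0 : (0 : ℝ) < W.card := by exact_mod_cast hposN
    have hU : ∑ p ∈ W, (∑' q : {q : EuclideanSpace ℝ (Fin 3) // q ∈ S ∧ q ≠ p}, lennardJones (dist p q.1)) ≤
        2 * groundStateEnergy lennardJones 3 W.card + CU * ∑ p ∈ W, (1 + Metric.infDist p (S \ ↑W))⁻¹ ^ 3 :=
      hCU x hx S hhull W hWS
    rw [hsumL W hWS] at hU
    have hE : groundStateEnergy lennardJones 3 W.card < W.card * (E⋆ + γ / 4) := by
      have h := hn₀ W.card ((Nat.le_succ n₀).trans hcard)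
      rwa [div_lt_iff₀ hn0, mul_comm] at h
    have hCB := hCη CU γ hγ _ _ (hB0 W) hn0.le hB
    have hCB' := le_abs_self (CU * ∑ p ∈ W, (1 + Metric.infDist p (S \ ↑W))⁻¹ ^ 3)
    have hγn : 0 < γ * W.card := mul_pos hγ hn0
    have h : (W.card : ℝ) * L < W.card * (2 * E⋆ + γ) := by linarith
    exact lt_of_mul_lt_mul_left h hn0.le
  · -- `2E* < L + γ`: ANY thin window, (L) and `n·E* ≤ E(n)`
    have hη0 : 0 < γ / (2 * (|CL| + 1)) := by positivity
    obtain ⟨W, hWS, hcard, hB⟩ := exists_thin_window hδ hS hinf hη0 0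
    have hposN : 0 < W.card := lt_of_lt_of_le (Nat.succ_pos 0) hcard
    have hn0 : (0 : ℝ) < W.card := by exact_mod_cast hposN
    have hLw : 2 * groundStateEnergy lennardJones 3 W.card - CL * ∑ p ∈ W, (1 + Metric.infDist p (S \ ↑W))⁻¹ ^ 3 ≤
        ∑ p ∈ W, (∑' q : {q : EuclideanSpace ℝ (Fin 3) // q ∈ S ∧ q ≠ p}, lennardJones (dist p q.1)) :=
      hCL S hS W hWS
    rw [hsumL W hWS] at hLw
    have hE : (W.card : ℝ) * E⋆ ≤ groundStateEnergy lennardJones 3 W.card := by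
      have h : E⋆ ≤ groundStateEnergy lennardJones 3 W.card / W.card :=
        Summit.AtomisticToContinuum.Crystallization.Theorems.ChargedEnergyGapNegative.eStar_le_groundStateEnergy_div
          hposN
      rwa [le_div_iff₀ hn0, mul_comm] at h
    have hCB := hCη CL γ hγ _ _ (hB0 W) hn0.le hB
    have hCB' := le_abs_self (CL * ∑ p ∈ W, (1 + Metric.infDist p (S \ ↑W))⁻¹ ^ 3)
    have hγn : 0 < γ * W.card := mul_pos hγ hn0
    have h : (W.card : ℝ) * (2 * E⋆) < W.card * (L + γ) := by linarith
    exact lt_of_mul_lt_mul_left h hn0.le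

/-- **HomogeneousInfiniteLocalLimit** — §5's `HomogeneousLocalLimit` with the local limit required INFINITE
(instead of merely non-empty): some local limit of every ground-state sequence is infinite, uniformly discrete and
has CONSTANT Lennard-Jones site sums (level unspecified). -/
def HomogeneousInfiniteLocalLimit : Prop :=
  ∀ x : (N : ℕ) → (Fin N → EuclideanSpace ℝ (Fin 3)), (∀ N, IsGroundState lennardJones (x N)) →
    ∃ (X : Set (EuclideanSpace ℝ (Fin 3))) (σ : ℕ → ℕ) (τ : ℕ → EuclideanSpace ℝ (Fin 3)) (L : ℝ),
      X.Infinite ∧ (∃ δ : ℝ, 0 < δ ∧ ∀ p ∈ X, ∀ q ∈ X, p ≠ q → δ ≤ dist p q) ∧ StrictMono σ ∧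
      (∀ R ε : ℝ, 0 < ε → ∀ᶠ j : ℕ in atTop,
        (∀ p ∈ X, ‖p‖ ≤ R → ∃ i : Fin (σ j), dist (x (σ j) i + τ j) p ≤ ε) ∧
        (∀ i : Fin (σ j), ‖x (σ j) i + τ j‖ ≤ R → ∃ p ∈ X, dist (x (σ j) i + τ j) p ≤ ε)) ∧
      ∀ p ∈ X, ∑' q : {q : EuclideanSpace ℝ (Fin 3) // q ∈ X ∧ q ≠ p}, lennardJones (dist p q.1) = L

/-- **`LevelCap` and `LevelFloor` for infinite local limits (PROVED)**: an infinite homogeneous local limit of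
Lennard-Jones ground states has level exactly `2E*`. -/
theorem level_eq_of_localLimit {x : (N : ℕ) → (Fin N → EuclideanSpace ℝ (Fin 3))}
    (hx : ∀ N, IsGroundState lennardJones (x N)) {X : Set (EuclideanSpace ℝ (Fin 3))} (hinf : X.Infinite)
    {σ : ℕ → ℕ} {τ : ℕ → EuclideanSpace ℝ (Fin 3)} (hσ : StrictMono σ)
    (hlim : ∀ R ε : ℝ, 0 < ε → ∀ᶠ j : ℕ in atTop,
        (∀ p ∈ X, ‖p‖ ≤ R → ∃ i : Fin (σ j), dist (x (σ j) i + τ j) p ≤ ε) ∧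
        (∀ i : Fin (σ j), ‖x (σ j) i + τ j‖ ≤ R → ∃ p ∈ X, dist (x (σ j) i + τ j) p ≤ ε))
    {L : ℝ} (hL : ∀ p ∈ X, ∑' q : {q : EuclideanSpace ℝ (Fin 3) // q ∈ X ∧ q ≠ p},
      lennardJones (dist p q.1) = L) :
    L = 2 * E⋆ :=
  level_eq_of_hull_homogeneous hx hinf (hull_of_localLimit hσ hlim) hL

/-- **The crux from an infinite homogeneous local limit (PROVED, level-free):**
`HomogeneousInfiniteLocalLimit → TransitiveLocalLimit`.  The level clause `= 2E*` of the crux is automatic;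
what remains is pure energy-TRANSITIVITY of some infinite local limit of the ground states. -/
theorem transitiveLocalLimit_of_homogeneousInfiniteLocalLimit (h : HomogeneousInfiniteLocalLimit) :
    TransitiveLocalLimit := by
  intro x hx
  obtain ⟨X, σ, τ, L, hinf, hsep, hσ, hlim, hU⟩ := h x hx
  have hL : L = 2 * E⋆ := level_eq_of_localLimit hx hinf hσ hlim hU
  exact ⟨X, σ, τ, hinf.nonempty, hsep, hσ, hlim, fun p hp => (hU p hp).trans hL⟩

/-- Conversely the crux gives `HomogeneousInfiniteLocalLimit` as soon as its local limit is infinite (a finite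
local limit of ground states — an isolated cluster — is excluded by minimality; that exclusion is the only
unformalised edge of the equivalence `TransitiveLocalLimit ⟺ HomogeneousInfiniteLocalLimit`). -/
theorem homogeneousInfiniteLocalLimit_of_transitiveLocalLimit_infinite
    (h : ∀ x : (N : ℕ) → (Fin N → EuclideanSpace ℝ (Fin 3)), (∀ N, IsGroundState lennardJones (x N)) →
      ∃ (X : Set (EuclideanSpace ℝ (Fin 3))) (σ : ℕ → ℕ) (τ : ℕ → EuclideanSpace ℝ (Fin 3)),
        X.Infinite ∧ (∃ δ : ℝ, 0 < δ ∧ ∀ p ∈ X, ∀ q ∈ X, p ≠ q → δ ≤ dist p q) ∧ StrictMono σ ∧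
        (∀ R ε : ℝ, 0 < ε → ∀ᶠ j : ℕ in atTop,
          (∀ p ∈ X, ‖p‖ ≤ R → ∃ i : Fin (σ j), dist (x (σ j) i + τ j) p ≤ ε) ∧
          (∀ i : Fin (σ j), ‖x (σ j) i + τ j‖ ≤ R → ∃ p ∈ X, dist (x (σ j) i + τ j) p ≤ ε)) ∧
        ∀ p ∈ X, ∑' q : {q : EuclideanSpace ℝ (Fin 3) // q ∈ X ∧ q ≠ p}, lennardJones (dist p q.1) = 2 * E⋆) :
    HomogeneousInfiniteLocalLimit := fun x hx => by
  obtain ⟨X, σ, τ, hinf, hsep, hσ, hlim, hU⟩ := h x hx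
  exact ⟨X, σ, τ, 2 * E⋆, hinf, hsep, hσ, hlim, hU⟩

end Summit.AtomisticToContinuum.Crystallization.Cruxes.TransitiveLocalLimit.StrategistR1

end
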